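import Summits.Ventures.Crystal3D.Theorems.StickyWulffConstantCoaxialWallLawSeamEndBallRigidity
import HarnessLib

/-!
# `ThreePayer` SPLIT BY READER TYPE: the deg-12 case is `SatCensus12` (certificate-shaped, '…SeamSatCensusTwelve'); the deg-11 case is one named census fact per
# move kind of the end pair — FULL, CROSS (finite under E1, seat 19481-p2 g14 memo §5), GLIDE, NARROW (the amorphous remainder)
# (crux `CoaxialWallLaw`, stmt-Ventures-19481; lane F 'Certificates' v8.3R, registered stub `stub_threePayer`; cf-p1 (cclxxxi) line (L2))

HONEST FRAMING. Venture `Summits/Ventures/Crystal3D` (cell `crystal3d-full`); helper for `stub_threePayer`.  cf-p1 (cclxxxi): the line of record of `ThreePayer` is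
two-pronged; prong (L2) is the READER-TYPE SPLIT, to be registered «only with the glue proved and each piece typed over `IsEndPairA`'s move kind».  THIS FILE is
that glue.  `threePayer_of_census` ('…SeamEndBallRigidity') already reduces `ThreePayer` to `SatCensus11 ∧ SatCensus12`; here the deg-11 fact is asked ONLY at
(A)-end balls and separately for each kind of end move (`IsEndMove`): the mover `q` reads FULL (all twelve slots of `q` occupied), NARROW (`v2`: target + positive
triple), GLIDE (twin reading, in-plane direction) — these three with `b = q + d` — or CROSS (twin reading across the normal, `b = q − M_m d`, mirrored class).
* `SatCensus11Full`, `SatCensus11Narrow`, `SatCensus11Glide`, `SatCensus11Cross` — «an (A)-end ball of that kind with exactly eleven contacts has two distinct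
  contact-neighbours with at most eleven contacts each» (all data of `IsEndPairA` carried as hypotheses: membership, two-payer clause, admissible class, predecessor,
  reading, position, non-moving target);
* `satCensus11Kinds_of_satCensus11` — the unrestricted `SatCensus11` implies all four (so (L1) ⊆ (L2));
* **`threePayer_of_kinds : SatCensus12 → SatCensus11Full → SatCensus11Narrow → SatCensus11Glide → SatCensus11Cross → ThreePayer`** — the glue: `deg b ≤ 10`
  (two units at `b`, one at the payer), `deg b = 11` (the piece of `b`'s kind gives a second unsaturated neighbour besides the payer), `deg b = 12` (END-BALL RIGIDITY
  `not_arranged_of_isEndPairA` + `SatCensus12`).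
STATUS OF THE PIECES (seat 19481-p2 g14, memo HOME/wall-19481-p2/F-TAIL-g14.md): `SatCensus12` ⇐ `KissingClassificationOneFree (5/2)` (landed reduction, certificate C1);
FULL: finite under E1 (85 multi-twin rows; the 16 vacancy rows ⇐ `VacancyCapFcc` via '…SeamVacancyCensus'); CROSS: alike (E1 at the mirror balls); GLIDE: partial (hStar
co-neighbours); NARROW: open (amorphous saturation; numerics P4/P6 only).
WHAT THIS IS NOT: no piece is proved here; F-C1 not moved.
-/

noncomputable section

namespace Summit.Ventures.Crystal3D.Theorems

namespace TailResidue

open Summit.Ventures.Crystal3D Finset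
open Literature.Geometry.DiscreteGeometry (fccKissingPattern hcpKissingPattern IsArrangedIn)
open scoped InnerProductSpace

/-! ### The four deg-11 census facts, one per move kind -/

open scoped Classical in
/-- **Deg-11 census at FULL-reader ends (named input).**  In a `1`-separated `X`, for slot-rooted plate systems: if `q` reads FULL in an admissible class `(G, d)` (all
twelve slots `q + G w` occupied), has its predecessor `q − d`, and moves straight onto the non-moving end ball `b = q + d` (two-payer clause at `b`), and `b` has exactly
eleven contacts, then two distinct contact-neighbours of `b` have at most eleven contacts each. -/
def SatCensus11Full : Prop :=
  ∀ X : Finset (EuclideanSpace ℝ (Fin 3)), (∀ p ∈ X, ∀ p' ∈ X, p ≠ p' → 1 ≤ dist p p') →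
  ∀ v : WordVersion, ∀ S₁ S₂ : PlateSystem, S₁.RT ⊆ fccSlots → S₂.RT ⊆ fccSlots →
  ∀ b q : EuclideanSpace ℝ (Fin 3), ∀ G : EuclideanSpace ℝ (Fin 3) ≃ₗᵢ[ℝ] EuclideanSpace ℝ (Fin 3), ∀ d : EuclideanSpace ℝ (Fin 3),
    q ∈ X → b ∈ X → HasTwoPayers X b → (S₁.Adm G d ∨ S₂.Adm G d) → q - d ∈ X →
    IsFull X G q → b = q + d → ¬ IsMoving X v G d b →
    (X.filter fun x => dist b x = 1).card = 11 →
    ∃ y ∈ X, ∃ y' ∈ X, y ≠ y' ∧ dist b y = 1 ∧ dist b y' = 1 ∧ (X.filter fun x => dist y x = 1).card ≤ 11 ∧ (X.filter fun x => dist y' x = 1).card ≤ 11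

open scoped Classical in
/-- **Deg-11 census at NARROW ends (named input; version `v2`)**: as `SatCensus11Full` with the NARROW reading of `q` (target `q + d` and the positive triple of a menu
normal crossing `d` upward occupied) — the amorphous regime: only the slot triangle `{q, t₂, t₃}` of `b`'s shell is exact. -/
def SatCensus11Narrow : Prop :=
  ∀ X : Finset (EuclideanSpace ℝ (Fin 3)), (∀ p ∈ X, ∀ p' ∈ X, p ≠ p' → 1 ≤ dist p p') →
  ∀ v : WordVersion, ∀ S₁ S₂ : PlateSystem, S₁.RT ⊆ fccSlots → S₂.RT ⊆ fccSlots →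
  ∀ b q : EuclideanSpace ℝ (Fin 3), ∀ G : EuclideanSpace ℝ (Fin 3) ≃ₗᵢ[ℝ] EuclideanSpace ℝ (Fin 3), ∀ d : EuclideanSpace ℝ (Fin 3),
    q ∈ X → b ∈ X → HasTwoPayers X b → (S₁.Adm G d ∨ S₂.Adm G d) → q - d ∈ X →
    (v = WordVersion.v2 ∧ IsNarrow X G d q) → b = q + d → ¬ IsMoving X v G d b →
    (X.filter fun x => dist b x = 1).card = 11 →
    ∃ y ∈ X, ∃ y' ∈ X, y ≠ y' ∧ dist b y = 1 ∧ dist b y' = 1 ∧ (X.filter fun x => dist y x = 1).card ≤ 11 ∧ (X.filter fun x => dist y' x = 1).card ≤ 11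

open scoped Classical in
/-- **Deg-11 census at GLIDE ends (named input)**: as `SatCensus11Full` with a TWIN reading `(G, m)` of `q` and an in-plane direction, `⟪d, m⟫ = 0`. -/
def SatCensus11Glide : Prop :=
  ∀ X : Finset (EuclideanSpace ℝ (Fin 3)), (∀ p ∈ X, ∀ p' ∈ X, p ≠ p' → 1 ≤ dist p p') →
  ∀ v : WordVersion, ∀ S₁ S₂ : PlateSystem, S₁.RT ⊆ fccSlots → S₂.RT ⊆ fccSlots →
  ∀ b q : EuclideanSpace ℝ (Fin 3), ∀ G : EuclideanSpace ℝ (Fin 3) ≃ₗᵢ[ℝ] EuclideanSpace ℝ (Fin 3), ∀ d : EuclideanSpace ℝ (Fin 3),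
    q ∈ X → b ∈ X → HasTwoPayers X b → (S₁.Adm G d ∨ S₂.Adm G d) → q - d ∈ X →
    (∃ m, IsTwinReading X G m q ∧ ⟪d, m⟫_ℝ = 0) → b = q + d → ¬ IsMoving X v G d b →
    (X.filter fun x => dist b x = 1).card = 11 →
    ∃ y ∈ X, ∃ y' ∈ X, y ≠ y' ∧ dist b y = 1 ∧ dist b y' = 1 ∧ (X.filter fun x => dist y x = 1).card ≤ 11 ∧ (X.filter fun x => dist y' x = 1).card ≤ 11

open scoped Classical in
/-- **Deg-11 census at CROSS ends (named input)**: `q` twin-reads `(G, m)` with `⟪d, m⟫ = √(2/3)` and crosses the plane onto `b = q − (d − 2⟪d, m⟫ m)`, the target not moving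
in the mirrored class `(G ∘ M_m, b − q)`. -/
def SatCensus11Cross : Prop :=
  ∀ X : Finset (EuclideanSpace ℝ (Fin 3)), (∀ p ∈ X, ∀ p' ∈ X, p ≠ p' → 1 ≤ dist p p') →
  ∀ v : WordVersion, ∀ S₁ S₂ : PlateSystem, S₁.RT ⊆ fccSlots → S₂.RT ⊆ fccSlots →
  ∀ b q : EuclideanSpace ℝ (Fin 3), ∀ G : EuclideanSpace ℝ (Fin 3) ≃ₗᵢ[ℝ] EuclideanSpace ℝ (Fin 3), ∀ d : EuclideanSpace ℝ (Fin 3),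
    q ∈ X → b ∈ X → HasTwoPayers X b → (S₁.Adm G d ∨ S₂.Adm G d) → q - d ∈ X →
    (∃ m, IsTwinReading X G m q ∧ ⟪d, m⟫_ℝ = Real.sqrt (2 / 3) ∧ b = q - (d - (2 * ⟪d, m⟫_ℝ) • m) ∧
      ¬ IsMoving X v (G.trans (ℝ ∙ m)ᗮ.reflection) (b - q) b) →
    (X.filter fun x => dist b x = 1).card = 11 →
    ∃ y ∈ X, ∃ y' ∈ X, y ≠ y' ∧ dist b y = 1 ∧ dist b y' = 1 ∧ (X.filter fun x => dist y x = 1).card ≤ 11 ∧ (X.filter fun x => dist y' x = 1).card ≤ 11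

/-- The unrestricted `SatCensus11` implies the four kind-restricted facts (prong (L1) is contained in prong (L2)). -/
theorem satCensus11Kinds_of_satCensus11 (h : SatCensus11) : SatCensus11Full ∧ SatCensus11Narrow ∧ SatCensus11Glide ∧ SatCensus11Cross := by
  refine ⟨?_, ?_, ?_, ?_⟩
  · intro X hX _ _ _ _ _ b _ _ _ _ hb _ _ _ _ _ _ h11; exact h X hX b hb h11
  · intro X hX _ _ _ _ _ b _ _ _ _ hb _ _ _ _ _ _ h11; exact h X hX b hb h11
  · intro X hX _ _ _ _ _ b _ _ _ _ hb _ _ _ _ _ _ h11; exact h X hX b hb h11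
  · intro X hX _ _ _ _ _ b _ _ _ _ hb _ _ _ _ h11; exact h X hX b hb h11

/-! ### The glue -/

open scoped Classical in
/-- **Two unsaturated contact-neighbours at a deg-11 (A)-end ball, from the four kind-restricted facts** (case analysis on `IsEndMove`). -/
theorem two_unsaturated_of_isEndPairA_eleven (cF : SatCensus11Full) (cN : SatCensus11Narrow) (cG : SatCensus11Glide) (cC : SatCensus11Cross)
    {X : Finset (EuclideanSpace ℝ (Fin 3))} (hX : ∀ p ∈ X, ∀ p' ∈ X, p ≠ p' → 1 ≤ dist p p') {v : WordVersion} {S₁ S₂ : PlateSystem}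
    (h₁ : S₁.RT ⊆ fccSlots) (h₂ : S₂.RT ⊆ fccSlots) {b q : EuclideanSpace ℝ (Fin 3)} (hp : IsEndPairA X v S₁ S₂ b q)
    (h11 : (X.filter fun x => dist b x = 1).card = 11) :
    ∃ y ∈ X, ∃ y' ∈ X, y ≠ y' ∧ dist b y = 1 ∧ dist b y' = 1 ∧ (X.filter fun x => dist y x = 1).card ≤ 11 ∧ (X.filter fun x => dist y' x = 1).card ≤ 11 := by
  obtain ⟨hq, hb, h2p, G, d, hadm, hpred, hmove⟩ := hp
  rcases hmove with ⟨hrd, hbq, hnm⟩ | hcross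
  · rcases hrd with hf | hn | hg
    · exact cF X hX v S₁ S₂ h₁ h₂ b q G d hq hb h2p hadm hpred hf hbq hnm h11
    · exact cN X hX v S₁ S₂ h₁ h₂ b q G d hq hb h2p hadm hpred hn hbq hnm h11
    · exact cG X hX v S₁ S₂ h₁ h₂ b q G d hq hb h2p hadm hpred hg hbq hnm h11
  · exact cC X hX v S₁ S₂ h₁ h₂ b q G d hq hb h2p hadm hpred hcross h11

open scoped Classical in
/-- **`ThreePayer` FROM THE SPLIT**: `SatCensus12` (deg-12 ends, via END-BALL RIGIDITY) and the four deg-11 kind facts.  Proof as `threePayer_of_census`: pooled deficiency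
counts `b` (two units if `deg b ≤ 10`), the payer `z`, and the second unsaturated neighbour supplied by the piece of `b`'s kind. -/
theorem threePayer_of_kinds (c12 : SatCensus12) (cF : SatCensus11Full) (cN : SatCensus11Narrow) (cG : SatCensus11Glide) (cC : SatCensus11Cross) : ThreePayer := by
  intro Y hY z hz hdeg v S₁ S₂ h₁ h₂ b q hzb hbz hp
  have hb : b ∈ Y := hp.2.1
  set S := Y.filter (fun y => dist b y ≤ 1 ∧ (Y.filter fun x => dist y x = 1).card ≤ 11) with hS
  have hterm : ∀ y ∈ S, (1 : ℝ) ≤ (12 : ℝ) - ((Y.filter fun x => dist y x = 1).card : ℝ) := by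
    intro y hy
    have : ((Y.filter fun x => dist y x = 1).card : ℝ) ≤ 11 := by exact_mod_cast (mem_filter.1 hy).2.2
    linarith
  have hnonneg : ∀ y ∈ S, (0 : ℝ) ≤ (12 : ℝ) - ((Y.filter fun x => dist y x = 1).card : ℝ) := fun y hy => (zero_le_one.trans (hterm y hy))
  have hzS : z ∈ S := mem_filter.2 ⟨hz, by rwa [dist_comm], hdeg⟩
  have h12b := card_filter_dist_eq_one_le_twelve Y hY b
  unfold pooledDef
  by_cases h10 : (Y.filter fun x => dist b x = 1).card ≤ 10
  · have hbS : b ∈ S := mem_filter.2 ⟨hb, by simp, by omega⟩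
    have hsub : ({b, z} : Finset (EuclideanSpace ℝ (Fin 3))) ⊆ S := insert_subset hbS (singleton_subset_iff.2 hzS)
    have hbterm : (2 : ℝ) ≤ (12 : ℝ) - ((Y.filter fun x => dist b x = 1).card : ℝ) := by
      have : ((Y.filter fun x => dist b x = 1).card : ℝ) ≤ 10 := by exact_mod_cast h10
      linarith
    calc (3 : ℝ) ≤ ((12 : ℝ) - ((Y.filter fun x => dist b x = 1).card : ℝ)) + ((12 : ℝ) - ((Y.filter fun x => dist z x = 1).card : ℝ)) := by
          linarith [hterm z hzS]
      _ = ∑ y ∈ ({b, z} : Finset (EuclideanSpace ℝ (Fin 3))), ((12 : ℝ) - ((Y.filter fun x => dist y x = 1).card : ℝ)) := by rw [sum_pair hbz]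
      _ ≤ ∑ y ∈ S, ((12 : ℝ) - ((Y.filter fun x => dist y x = 1).card : ℝ)) := sum_le_sum_of_subset_of_nonneg hsub fun y hy _ => hnonneg y hy
  · by_cases h11 : (Y.filter fun x => dist b x = 1).card = 11
    · obtain ⟨y, hy, y', hy', hne, hd, hd', hle, hle'⟩ := two_unsaturated_of_isEndPairA_eleven cF cN cG cC hY h₁ h₂ hp h11
      have hbS : b ∈ S := mem_filter.2 ⟨hb, by simp, by omega⟩
      have hyS : y ∈ S := mem_filter.2 ⟨hy, hd.le, hle⟩
      have hy'S : y' ∈ S := mem_filter.2 ⟨hy', hd'.le, hle'⟩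
      have hby : b ≠ y := fun h => by rw [← h, dist_self] at hd; exact zero_ne_one hd
      have hby' : b ≠ y' := fun h => by rw [← h, dist_self] at hd'; exact zero_ne_one hd'
      have hsub : ({b, y, y'} : Finset (EuclideanSpace ℝ (Fin 3))) ⊆ S := insert_subset hbS (insert_subset hyS (singleton_subset_iff.2 hy'S))
      have hcard : ({b, y, y'} : Finset (EuclideanSpace ℝ (Fin 3))).card = 3 := by
        rw [card_insert_of_notMem (by simp [hby, hby']), card_pair hne]
      calc (3 : ℝ) = ∑ _y ∈ ({b, y, y'} : Finset (EuclideanSpace ℝ (Fin 3))), (1 : ℝ) := by simp [hcard]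
        _ ≤ ∑ w ∈ ({b, y, y'} : Finset (EuclideanSpace ℝ (Fin 3))), ((12 : ℝ) - ((Y.filter fun x => dist w x = 1).card : ℝ)) :=
            sum_le_sum fun w hw => hterm w (hsub hw)
        _ ≤ ∑ w ∈ S, ((12 : ℝ) - ((Y.filter fun x => dist w x = 1).card : ℝ)) := sum_le_sum_of_subset_of_nonneg hsub fun w hw _ => hnonneg w hw
    · have h12 : (Y.filter fun x => dist b x = 1).card = 12 := by omega
      have hsum := c12 Y hY b hb h12 (not_arranged_of_isEndPairA h₁ h₂ hp)
      refine hsum.trans (sum_le_sum_of_subset_of_nonneg (fun y hy => ?_) fun y hy _ => hnonneg y hy)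
      obtain ⟨hyY, hd, hle⟩ := mem_filter.1 hy
      exact mem_filter.2 ⟨hyY, hd.le, hle⟩

end TailResidue

end Summit.Ventures.Crystal3D.Theorems

end
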